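import Summits.ValiantsHypothesis.ValiantsHypothesis.Theorems.SymPencilPerFourPeeledTwoPencilCaseAFrame
import Summits.ValiantsHypothesis.ValiantsHypothesis.Theorems.SymPencilPerFourPeeledTransport

/-!
# Route `SymPencil` — `2 | 2` inner rank of `per_4`, PEELED case at `≤ 11` squares: two-pencil
# frames under a COORDINATE PERMUTATION, and the Case-A frames of every index
# (`--supports` stmt-ValiantsHypothesis-5674 `SdcSuperquadratic`; (8,8) column; rung currency only)

The hypothesis `hframes` of `…PeeledTwoPencilReduction.false_of_peeled_of_frames` (val-lit-p8 g15)
asks, for every correction matrix `Ψ`, for a two-pencil frame.  Frames transport along a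
simultaneous permutation `σ` of the four coordinates: a frame for `(Ψ.submatrix σ σ, a₀ ∘ σ,
a₁ ∘ σ)` yields one for `(Ψ, a₀, a₁)` (`frame_of_perm`: `y_i ↦ y_i ∘ σ⁻¹`, all matrices
re-indexed by `σ⁻¹`, eigenvalues unchanged; the permanent is invariant, `…PeeledTransport.
per_comp_perm`).  Consequently the Case-A frames of `…TwoPencilCaseAFrame.exists_caseA_frame`
(distinguished index `3`) exist for EVERY distinguished index `m = σ 3`
(`exists_caseA_frame_perm`): `a₀` with non-zero coordinates whose constraint vector
`a₀ ∘ (a₀ᵀΨ)` takes three pairwise distinct non-zero values at `σ 0, σ 1, σ 2`, and any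
`a₁ ∉ K a₀` with `(a₁ᵀΨ)_k = 0` for `k ≠ σ 3`.

Honest framing: tools for the (8,8,11) case analysis; the case split over `Ψ`, the `Σ₀` and swap
classes are not here; no cell closes here; `sdc(per_4)`, the crux `SdcSuperquadratic` and
`VP ≠ VNP` are untouched.  No definitions, no named facts. [folklore]
-/

noncomputable section

-- single-conjunct layout: Sub = Summit, duplicated namespace component intended
set_option linter.dupNamespace false

namespace Summit.ValiantsHypothesis.ValiantsHypothesis.Theorems.SymPencilPerFourPeeledTwoPencilFramePerm

open Matrix Finset
open Summit.ValiantsHypothesis.ValiantsHypothesis.Theorems.SymPencilPerFourInnerRankPairs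
open Summit.ValiantsHypothesis.ValiantsHypothesis.Theorems.SymPencilPerFourPeeledTransport
open Summit.ValiantsHypothesis.ValiantsHypothesis.Theorems.SymPencilPerFourPeeledTwoPencilCaseAFrame

universe u

variable {K : Type u} [Field K]

/-- `per(a; e_b; y ∘ σ⁻¹; e_l) = per(a ∘ σ; e_{σ⁻¹ b}; y; e_{σ⁻¹ l})`. [folklore] -/
theorem per_frame_perm (σ : Equiv.Perm (Fin 4)) (a y : Fin 4 → K) (b l : Fin 4) :
    (Matrix.of ![a, Pi.single b (1 : K), y ∘ σ.symm, Pi.single l 1]).permanent =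
      (Matrix.of ![a ∘ σ, Pi.single (σ.symm b) (1 : K), y, Pi.single (σ.symm l) 1]).permanent := by
  rw [← per_comp_perm σ a (Pi.single b 1) (y ∘ σ.symm) (Pi.single l 1), single_comp_perm,
    single_comp_perm]
  have : (y ∘ σ.symm) ∘ σ = y := by funext k; simp
  rw [this]

/-- **Two-pencil frames transport along a coordinate permutation.**  A frame (in the format of
`hframes` of `…PeeledTwoPencilReduction.false_of_peeled_of_frames`) for
`(Ψ.submatrix σ σ, a₀ ∘ σ, a₁ ∘ σ)` yields a frame for `(Ψ, a₀, a₁)`. [folklore] -/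
theorem frame_of_perm (σ : Equiv.Perm (Fin 4)) (Ψ : Matrix (Fin 4) (Fin 4) K)
    (a₀ a₁ y₀ y₁ : Fin 4 → K) (P₀₀ P₁₀ P₀₁ P₁₁ W₀ : Matrix (Fin 4) (Fin 4) K)
    (v : Fin 4 → Fin 4 → K) (s : Fin 4 → K) (W : Matrix (Fin 4) (Fin 4) K)
    (hψ₀₀ : (a₀ ∘ σ) ⬝ᵥ Ψ.submatrix σ σ *ᵥ y₀ = 0) (hψ₀₁ : (a₀ ∘ σ) ⬝ᵥ Ψ.submatrix σ σ *ᵥ y₁ = 0)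
    (hψ₁₀ : (a₁ ∘ σ) ⬝ᵥ Ψ.submatrix σ σ *ᵥ y₀ = 0) (hψ₁₁ : (a₁ ∘ σ) ⬝ᵥ Ψ.submatrix σ σ *ᵥ y₁ = 0)
    (hP₀₀ : ∀ b l, P₀₀ b l = (Matrix.of ![a₀ ∘ σ, Pi.single b 1, y₀, Pi.single l 1]).permanent)
    (hP₁₀ : ∀ b l, P₁₀ b l = (Matrix.of ![a₀ ∘ σ, Pi.single b 1, y₁, Pi.single l 1]).permanent)
    (hP₀₁ : ∀ b l, P₀₁ b l = (Matrix.of ![a₁ ∘ σ, Pi.single b 1, y₀, Pi.single l 1]).permanent)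
    (hP₁₁ : ∀ b l, P₁₁ b l = (Matrix.of ![a₁ ∘ σ, Pi.single b 1, y₁, Pi.single l 1]).permanent)
    (hW₀ : W₀ * P₀₀ = 1) (hv : ∀ j, P₁₀ *ᵥ v j = s j • P₀₀ *ᵥ v j)
    (hs : ∀ i j, i ≠ j → s i ≠ s j) (hW : W * Matrix.of v = 1) (hQ : P₁₁ - P₁₀ * W₀ * P₀₁ ≠ 0) :
    ∃ (y₀ y₁ : Fin 4 → K) (P₀₀ P₁₀ P₀₁ P₁₁ W₀ : Matrix (Fin 4) (Fin 4) K)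
      (v : Fin 4 → Fin 4 → K) (s : Fin 4 → K) (W : Matrix (Fin 4) (Fin 4) K),
      a₀ ⬝ᵥ Ψ *ᵥ y₀ = 0 ∧ a₀ ⬝ᵥ Ψ *ᵥ y₁ = 0 ∧ a₁ ⬝ᵥ Ψ *ᵥ y₀ = 0 ∧ a₁ ⬝ᵥ Ψ *ᵥ y₁ = 0 ∧
      (∀ b l, P₀₀ b l = (Matrix.of ![a₀, Pi.single b 1, y₀, Pi.single l 1]).permanent) ∧
      (∀ b l, P₁₀ b l = (Matrix.of ![a₀, Pi.single b 1, y₁, Pi.single l 1]).permanent) ∧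
      (∀ b l, P₀₁ b l = (Matrix.of ![a₁, Pi.single b 1, y₀, Pi.single l 1]).permanent) ∧
      (∀ b l, P₁₁ b l = (Matrix.of ![a₁, Pi.single b 1, y₁, Pi.single l 1]).permanent) ∧
      W₀ * P₀₀ = 1 ∧ (∀ j, P₁₀ *ᵥ v j = s j • P₀₀ *ᵥ v j) ∧ (∀ i j, i ≠ j → s i ≠ s j) ∧
      W * Matrix.of v = 1 ∧ P₁₁ - P₁₀ * W₀ * P₀₁ ≠ 0 := by
  classical
  -- `ψ` transports: `a ⬝ Ψ (y ∘ σ⁻¹) = (a ∘ σ) ⬝ Ψ^σ y`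
  have hdot : ∀ a y : Fin 4 → K,
      a ⬝ᵥ Ψ *ᵥ (y ∘ σ.symm) = (a ∘ σ) ⬝ᵥ Ψ.submatrix σ σ *ᵥ y := by
    intro a y
    rw [Matrix.submatrix_mulVec_equiv, comp_equiv_dotProduct_comp_equiv]
  refine ⟨y₀ ∘ σ.symm, y₁ ∘ σ.symm, P₀₀.submatrix σ.symm σ.symm, P₁₀.submatrix σ.symm σ.symm,
    P₀₁.submatrix σ.symm σ.symm, P₁₁.submatrix σ.symm σ.symm, W₀.submatrix σ.symm σ.symm,
    fun j => v j ∘ σ.symm, s, W.submatrix σ.symm id, ?_, ?_, ?_, ?_, ?_, ?_, ?_, ?_, ?_, ?_, hs,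
    ?_, ?_⟩
  · rw [hdot]; exact hψ₀₀
  · rw [hdot]; exact hψ₀₁
  · rw [hdot]; exact hψ₁₀
  · rw [hdot]; exact hψ₁₁
  · intro b l; rw [Matrix.submatrix_apply, hP₀₀, per_frame_perm]
  · intro b l; rw [Matrix.submatrix_apply, hP₁₀, per_frame_perm]
  · intro b l; rw [Matrix.submatrix_apply, hP₀₁, per_frame_perm]
  · intro b l; rw [Matrix.submatrix_apply, hP₁₁, per_frame_perm]
  · rw [Matrix.submatrix_mul_equiv, hW₀, Matrix.submatrix_one_equiv]
  · intro j
    rw [Matrix.submatrix_mulVec_equiv, Matrix.submatrix_mulVec_equiv, Equiv.symm_symm]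
    have : (v j ∘ σ.symm) ∘ σ = v j := by funext k; simp
    rw [this, hv j]
    rfl
  · have e : (Matrix.of fun j => v j ∘ σ.symm) = (Matrix.of v).submatrix id σ.symm := rfl
    rw [e]
    have := Matrix.submatrix_mul_equiv W (Matrix.of v) σ.symm (Equiv.refl (Fin 4)) σ.symm
    simp only [Equiv.coe_refl] at this
    rw [this, hW, Matrix.submatrix_one_equiv]
  · intro h0
    apply hQ
    have e : (P₁₁ - P₁₀ * W₀ * P₀₁).submatrix σ.symm σ.symm = 0 := by
      rw [Matrix.submatrix_sub, Pi.sub_apply, Pi.sub_apply]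
      rw [Matrix.submatrix_mul_equiv, Matrix.submatrix_mul_equiv] at h0
      exact h0
    have := congrArg (fun N : Matrix (Fin 4) (Fin 4) K => N.submatrix σ σ) e
    simpa [Matrix.submatrix_submatrix] using this

/-- **Case-A frames of every distinguished index `σ 3`** (`exists_caseA_frame` transported by
`frame_of_perm`), in the format of `hframes` of
`…PeeledTwoPencilReduction.false_of_peeled_of_frames`. [folklore] -/
theorem exists_caseA_frame_perm [CharZero K] (σ : Equiv.Perm (Fin 4))
    (Ψ : Matrix (Fin 4) (Fin 4) K) (a₀ a₁ : Fin 4 → K)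
    (ha : ∀ k, a₀ k ≠ 0) (hind : ∀ μ : K, a₁ ≠ μ • a₀) (ha₁ : ∀ k, k ≠ σ 3 → (a₁ ᵥ* Ψ) k = 0)
    (h0 : a₀ (σ 0) * (a₀ ᵥ* Ψ) (σ 0) ≠ 0) (h1 : a₀ (σ 1) * (a₀ ᵥ* Ψ) (σ 1) ≠ 0)
    (h2 : a₀ (σ 2) * (a₀ ᵥ* Ψ) (σ 2) ≠ 0)
    (h01 : a₀ (σ 0) * (a₀ ᵥ* Ψ) (σ 0) ≠ a₀ (σ 1) * (a₀ ᵥ* Ψ) (σ 1))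
    (h02 : a₀ (σ 0) * (a₀ ᵥ* Ψ) (σ 0) ≠ a₀ (σ 2) * (a₀ ᵥ* Ψ) (σ 2))
    (h12 : a₀ (σ 1) * (a₀ ᵥ* Ψ) (σ 1) ≠ a₀ (σ 2) * (a₀ ᵥ* Ψ) (σ 2)) :
    ∃ (y₀ y₁ : Fin 4 → K) (P₀₀ P₁₀ P₀₁ P₁₁ W₀ : Matrix (Fin 4) (Fin 4) K)
      (v : Fin 4 → Fin 4 → K) (s : Fin 4 → K) (W : Matrix (Fin 4) (Fin 4) K),
      a₀ ⬝ᵥ Ψ *ᵥ y₀ = 0 ∧ a₀ ⬝ᵥ Ψ *ᵥ y₁ = 0 ∧ a₁ ⬝ᵥ Ψ *ᵥ y₀ = 0 ∧ a₁ ⬝ᵥ Ψ *ᵥ y₁ = 0 ∧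
      (∀ b l, P₀₀ b l = (Matrix.of ![a₀, Pi.single b 1, y₀, Pi.single l 1]).permanent) ∧
      (∀ b l, P₁₀ b l = (Matrix.of ![a₀, Pi.single b 1, y₁, Pi.single l 1]).permanent) ∧
      (∀ b l, P₀₁ b l = (Matrix.of ![a₁, Pi.single b 1, y₀, Pi.single l 1]).permanent) ∧
      (∀ b l, P₁₁ b l = (Matrix.of ![a₁, Pi.single b 1, y₁, Pi.single l 1]).permanent) ∧
      W₀ * P₀₀ = 1 ∧ (∀ j, P₁₀ *ᵥ v j = s j • P₀₀ *ᵥ v j) ∧ (∀ i j, i ≠ j → s i ≠ s j) ∧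
      W * Matrix.of v = 1 ∧ P₁₁ - P₁₀ * W₀ * P₀₁ ≠ 0 := by
  have hvm : ∀ a : Fin 4 → K, (a ∘ σ) ᵥ* Ψ.submatrix σ σ = (a ᵥ* Ψ) ∘ σ := by
    intro a
    rw [Matrix.submatrix_vecMul_equiv]
    have : (a ∘ σ) ∘ σ.symm = a := by funext k; simp
    rw [this]
  have ha' : ∀ k, (a₀ ∘ σ) k ≠ 0 := fun k => ha (σ k)
  have hind' : ∀ μ : K, a₁ ∘ σ ≠ μ • (a₀ ∘ σ) := by
    intro μ e
    apply hind μ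
    funext k
    have := congr_fun e (σ.symm k)
    simpa using this
  have ha₁' : ∀ k, k ≠ 3 → ((a₁ ∘ σ) ᵥ* Ψ.submatrix σ σ) k = 0 := by
    intro k hk
    rw [hvm]
    exact ha₁ (σ k) fun e => hk (σ.injective e)
  obtain ⟨y₀, y₁, P₀₀, P₁₀, P₀₁, P₁₁, W₀, v, s, W, c1, c2, c3, c4, c5, c6, c7, c8, c9, c10, c11,
      c12, c13⟩ :=
    exists_caseA_frame (Ψ.submatrix σ σ) (a₀ ∘ σ) (a₁ ∘ σ) ha' hind' ha₁'
      (by rw [hvm]; exact h0) (by rw [hvm]; exact h1) (by rw [hvm]; exact h2)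
      (by rw [hvm]; exact h01) (by rw [hvm]; exact h02) (by rw [hvm]; exact h12)
  exact frame_of_perm σ Ψ a₀ a₁ y₀ y₁ P₀₀ P₁₀ P₀₁ P₁₁ W₀ v s W c1 c2 c3 c4 c5 c6 c7 c8 c9 c10
    c11 c12 c13

end Summit.ValiantsHypothesis.ValiantsHypothesis.Theorems.SymPencilPerFourPeeledTwoPencilFramePerm

end
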